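import Literature.AlgebraicGeometry.Motives.GaloisDescentDatumOfTwists
import Literature.AlgebraicGeometry.Motives.GaloisDescentFunctor
import HarnessLib

/-!
# The complex FORM of the descended diagram and its Galois twists ([Deligne 1971] Prop. 5.10, the generic step «D3b»)

Topic `AlgebraicGeometry/Motives`; namespace `Literature.AlgebraicGeometry.Motives.GaloisDescentTwist`.  Continuation of
`GaloisDescentDatumOfTwists.lean` (lead's D1/D2: the setting `Z, Tw, k ⊆ F i ⊆ L ⊆ ℂ, M i, e i`, the model `N := M i₀ ⊗_{F i₀} L`
over `L`, the identification `ThetaIso : N ⊗_L ℂ ≅ Z`, the rigidity predicate `Good`) and of `GaloisDescentFunctor.lean` (P4: effective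
Galois descent of a diagram along `L / k` from a `GaloisDescentFunctor.Datum`).  GENERIC — no Shimura imports.

Given a descent datum `D : GaloisDescentFunctor.Datum k N` on the model over `L` whose action is `Good` at every level and every
`γ ∈ Gal(L/k)` (the output of D3a = P3-gen + D1), this file provides

* **`descendedForm D : D.descendedFunctor L ⋙ (· ×_k ℂ) ≅ Z`** — the complex FORM of the descended diagram `X₀ := N / Gal(L/k)` over
  `k`: tower `X₀ ⊗_k ℂ ≅ (X₀ ⊗_k L) ⊗_L ℂ` (✔ `bcFunctorTowerIso`), the descent identification `X₀ ⊗_k L ≅ N` (✔ `Datum.isoBaseChange`),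
  and `Θ : N ⊗_L ℂ ≅ Z` (✔ `ThetaIso`); component formulas `descendedForm_hom_app_left` / `descendedForm_inv_app_left`;
* **`descendedForm_conj_gal_eq_conjTheta_twistBC`** — for `σ̃ ∈ Aut(ℂ/k)` restricting to `γ` on `L`, the `e₀`-conjugate of the Galois
  automorphism `1 × Spec σ̃⁻¹` of `X₀ j ⊗_k ℂ` IS `Θ⁻¹ ≫ (ρ_j γ ⊠ σ̃) ≫ Θ` (tower ✔ `twistBC_gal_tower`, naturality of `⊠` along the
  identification ✔ `twistBC_naturality` + ✔ `Datum.aut_hom_iso_hom_left`);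
* **`tw_gal_descendedForm`** — hence, by `Good`, that conjugate is a TWIST for `σ̃`: the descended diagram over `k` satisfies the
  reciprocity «(62) for all `σ ∈ Aut(ℂ/k)`», which is what [Deligne1971TravauxShimura] Prop. 5.10 asserts for the model over the
  intersection `E = ⋂ Eᵢ` (the cell's consumer D4 reads `Tw := IsTwist` of the complex Shimura record system);
* `exists_descended_form_tw` — the same packaged as an existence statement (`∃ X₀ e₀, ∀ j σ̃, Tw j σ̃ (…)`).

Definitions by explicit formula + theorems; NO named fact, NO instance, NO `sorry`; net Literature debt 0.  HC_CM is proved only modulo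
the 7 printed citations until rung 0 closes; this file proves no cell binder by itself.

## References
* [Deligne1971TravauxShimura] P. Deligne, *Travaux de Shimura*, Sém. Bourbaki 389 (1971), Prop. 5.10 with Lemme 5.10.1 (pp. 157–158), Cor. 5.5.
* [Milne2005ShimuraVarieties] J. S. Milne, *Introduction to Shimura varieties* (2005), Def. 12.8 (62), Thm. 13.6, Thm. 13.7.
* [GortzWedhorn2020] U. Görtz, T. Wedhorn, *Algebraic Geometry I* (2nd ed. 2020), Prop. 4.16, §(4.8), §(14.20), Thm. 14.72 (1), Thm. 14.83.
* Tree: `Motives.GaloisDescentDatumOfTwists` (`N`, `ThetaIso`, `Theta`, `Theta_hom/_inv`, `conjTheta`, `Good`), `Motives.SemilinearAutBaseChange`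
  (`twistBC`, `twistBC_gal_tower`, `twistBC_naturality`, `gal_semilinear`), `Motives.GaloisDescentFunctor` (`Datum.descendedFunctor`,
  `Datum.isoBaseChange`, `Datum.iso`, `Datum.obj₀`, `Datum.aut_hom_iso_hom_left`), `Motives.AbelianVarietyBaseChangeTower` (`bcFunctorTowerIso`).
-/

set_option autoImplicit false

noncomputable section

open CategoryTheory CategoryTheory.Limits AlgebraicGeometry Cardinal

namespace Literature.AlgebraicGeometry.Motives

namespace GaloisDescentTwist

open AbelianVariety (bcSpec bcFunctor specAut bcFunctorTowerIso bcFunctor_map_injective)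
open GaloisDescent

set_option backward.isDefEq.respectTransparency false

section Form

variable {J : Type} [Category J] (Z : J ⥤ SchemeOver ℂ)
  (Tw : ∀ j : J, (ℂ ≃+* ℂ) → ((Z.obj j).left ⟶ (Z.obj j).left) → Prop)
  {k : Type} [Field k] (L : Type) [Field L] [Algebra k L] [Algebra L ℂ]
  {ι : Type} {F : ι → Type} [∀ i, Field (F i)] [∀ i, Algebra (F i) L] [∀ i, Algebra (F i) ℂ]
  [∀ i, IsScalarTower (F i) L ℂ]
  (M : ∀ i, J ⥤ SchemeOver (F i)) (e : ∀ i, (M i ⋙ bcFunctor (F i) ℂ) ≅ Z) (i₀ : ι)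
  [Algebra k ℂ] [IsScalarTower k L ℂ] [FiniteDimensional k L] [IsGalois k L]
  (D : GaloisDescentFunctor.Datum k (N L M i₀))

/-! ### §1. The complex form `e₀ : X₀ ⊗_k ℂ ≅ Z` of the descended diagram -/

/-- **The component at `j` of the complex form**: `X₀ j ⊗_k ℂ ≅ (X₀ j ⊗_k L) ⊗_L ℂ ≅ N j ⊗_L ℂ ≅ Z j` — tower isomorphism (inverted),
the descent identification `N j ≅ X₀ j ⊗_k L` inverted and base-changed to `ℂ`, then `Θ_{i₀}` at `j`.
[cite: Deligne1971TravauxShimura, Prop. 5.10 proof (pp. 157–158)] [cite: GortzWedhorn2020, Prop. 4.16 and Thm. 14.83] -/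
def formApp (j : J) : (bcFunctor k ℂ).obj (D.obj₀ L j) ≅ Z.obj j :=
  ((bcFunctorTowerIso k L ℂ).app (D.obj₀ L j)).symm ≪≫ (bcFunctor L ℂ).mapIso (D.iso L j).symm ≪≫
    (ThetaIso Z L M e i₀).app j

/-- Component formula (hom) on underlying schemes: `(tower⁻¹ at X₀ j).left ≫ ((D.iso j)⁻¹ ⊗ ℂ).left ≫ Θ_{i₀} j`. [cite: GortzWedhorn2020, Prop. 4.16] -/
theorem formApp_hom_left (j : J) :
    (formApp Z L M e i₀ D j).hom.left =
      ((bcFunctorTowerIso k L ℂ).inv.app (D.obj₀ L j)).left ≫ ((bcFunctor L ℂ).map (D.iso L j).inv).left ≫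
        (Theta Z L M e i₀ j).hom :=
  rfl

/-- Component formula (inv) on underlying schemes: `Θ_{i₀} j⁻¹ ≫ ((D.iso j) ⊗ ℂ).left ≫ (tower at X₀ j).left`. [cite: GortzWedhorn2020, Prop. 4.16] -/
theorem formApp_inv_left (j : J) :
    (formApp Z L M e i₀ D j).inv.left =
      (Theta Z L M e i₀ j).inv ≫ ((bcFunctor L ℂ).map (D.iso L j).hom).left ≫
        ((bcFunctorTowerIso k L ℂ).hom.app (D.obj₀ L j)).left := by
  simp only [formApp, Iso.trans_inv, Iso.symm_inv, Iso.app_hom, CategoryTheory.Functor.mapIso_inv, Over.comp_left, Category.assoc]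
  rfl

omit [Algebra L ℂ] [∀ i, Algebra (F i) ℂ] [∀ i, IsScalarTower (F i) L ℂ] [Algebra k ℂ] [IsScalarTower k L ℂ] in
/-- The descent identification, inverted, is natural: `(X₀.map f ⊗ L) ≫ ι_{j′}⁻¹ = ι_j⁻¹ ≫ N.map f`. [cite: GortzWedhorn2020, Thm. 14.72 (1)] -/
theorem map_map₀_comp_iso_inv {j j' : J} (f : j ⟶ j') :
    (bcFunctor k L).map (D.map₀ L f) ≫ (D.iso L j').inv = (D.iso L j).inv ≫ (N L M i₀).map f := by
  rw [Iso.comp_inv_eq, Category.assoc, Iso.eq_inv_comp, ← GaloisDescentFunctor.Datum.isoBaseChange_hom_app,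
    ← GaloisDescentFunctor.Datum.isoBaseChange_hom_app, ← GaloisDescentFunctor.Datum.descendedFunctor_map]
  exact ((D.isoBaseChange L).hom.naturality f).symm

omit [∀ i, Algebra (F i) ℂ] [∀ i, IsScalarTower (F i) L ℂ] in
/-- Naturality of the inverse tower isomorphism at the descended objects, on underlying schemes (composite functor unfolded by the
LEMMA `Functor.comp_map`, as in `GaloisDescentTwist.Theta_natural`). [cite: GortzWedhorn2020, Prop. 4.16] -/
theorem towerIso_inv_app_left_natural {j j' : J} (f : j ⟶ j') :
    ((bcFunctor k ℂ).map (D.map₀ L f)).left ≫ ((bcFunctorTowerIso k L ℂ).inv.app (D.obj₀ L j')).left =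
      ((bcFunctorTowerIso k L ℂ).inv.app (D.obj₀ L j)).left ≫
        ((bcFunctor L ℂ).map ((bcFunctor k L).map (D.map₀ L f))).left := by
  have h := congrArg CommaMorphism.left ((bcFunctorTowerIso k L ℂ).inv.naturality (D.map₀ L f))
  simp only [CategoryTheory.Functor.comp_map, Over.comp_left] at h
  exact h

omit [∀ i, Algebra (F i) ℂ] [∀ i, IsScalarTower (F i) L ℂ] [Algebra k ℂ] [IsScalarTower k L ℂ] in
/-- The descent identification, inverted and base-changed to `ℂ`, is natural — on underlying schemes. [cite: GortzWedhorn2020, Thm. 14.72 (1)] -/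
theorem map_iso_inv_left_natural {j j' : J} (f : j ⟶ j') :
    ((bcFunctor L ℂ).map ((bcFunctor k L).map (D.map₀ L f))).left ≫ ((bcFunctor L ℂ).map (D.iso L j').inv).left =
      ((bcFunctor L ℂ).map (D.iso L j).inv).left ≫ ((bcFunctor L ℂ).map ((N L M i₀).map f)).left := by
  rw [← Over.comp_left, ← Over.comp_left, ← CategoryTheory.Functor.map_comp, ← CategoryTheory.Functor.map_comp,
    map_map₀_comp_iso_inv]

/-- **Naturality of the components in `j`**, checked on underlying schemes (naturality of the tower isomorphism, of the descent
identification — i.e. `Datum.bcFunctor_map_map₀` — and of `Θ_{i₀}`, ✔ `Theta_natural`). [cite: GortzWedhorn2020, Prop. 4.16 and Thm. 14.72 (1)] -/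
theorem formApp_natural {j j' : J} (f : j ⟶ j') :
    (bcFunctor k ℂ).map (D.map₀ L f) ≫ (formApp Z L M e i₀ D j').hom = (formApp Z L M e i₀ D j).hom ≫ Z.map f := by
  apply Over.OverMorphism.ext
  rw [Over.comp_left, Over.comp_left, formApp_hom_left, formApp_hom_left, ← Category.assoc, towerIso_inv_app_left_natural,
    Category.assoc, ← Category.assoc ((bcFunctor L ℂ).map ((bcFunctor k L).map (D.map₀ L f))).left, map_iso_inv_left_natural,
    Category.assoc, Theta_natural, Category.assoc, Category.assoc]

/-- The component at `j`, RETYPED over the composite functor `X₀ ⋙ (· ×_k ℂ)` (same isomorphism; the object `(X₀ ⋙ bc).obj j` is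
`bc.obj (X₀ j)` by `Functor.comp_obj`, checked once here). [cite: GortzWedhorn2020, Prop. 4.16] -/
def formAppComp (j : J) : (D.descendedFunctor L ⋙ bcFunctor k ℂ).obj j ≅ Z.obj j :=
  formApp Z L M e i₀ D j

/-- `formAppComp = formApp` (by `rfl`). [cite: GortzWedhorn2020, Prop. 4.16] -/
theorem formAppComp_hom (j : J) : (formAppComp Z L M e i₀ D j).hom = (formApp Z L M e i₀ D j).hom := rfl

/-- `formAppComp = formApp`, inverse (by `rfl`). [cite: GortzWedhorn2020, Prop. 4.16] -/
theorem formAppComp_inv (j : J) : (formAppComp Z L M e i₀ D j).inv = (formApp Z L M e i₀ D j).inv := rfl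

/-- Naturality of the retyped components (= `formApp_natural`, the composite functor's `map` being `bc.map (X₀.map f)` by
`Functor.comp_map`, checked once here). [cite: GortzWedhorn2020, Prop. 4.16 and Thm. 14.72 (1)] -/
theorem formAppComp_natural {j j' : J} (f : j ⟶ j') :
    (D.descendedFunctor L ⋙ bcFunctor k ℂ).map f ≫ (formAppComp Z L M e i₀ D j').hom =
      (formAppComp Z L M e i₀ D j).hom ≫ Z.map f := by
  rw [CategoryTheory.Functor.comp_map, GaloisDescentFunctor.Datum.descendedFunctor_map, formAppComp_hom, formAppComp_hom]
  exact formApp_natural Z L M e i₀ D f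

/-- Generic packaging (kernel bookkeeping): a natural isomorphism `X₀ ⊗_k ℂ ≅ Z` from components on the COMPOSITE functor
`X₀ ⋙ (· ×_k ℂ)` and their naturality (Mathlib `NatIso.ofComponents`, with the composite functor bound as a variable so that the
kernel checks the instance once). [cite: GortzWedhorn2020, Prop. 4.16] -/
def natIsoOfComponentsComp {X₀ : J ⥤ SchemeOver k} (app : ∀ j : J, (X₀ ⋙ bcFunctor k ℂ).obj j ≅ Z.obj j)
    (nat : ∀ {j j' : J} (f : j ⟶ j'), (X₀ ⋙ bcFunctor k ℂ).map f ≫ (app j').hom = (app j).hom ≫ Z.map f) :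
    (X₀ ⋙ bcFunctor k ℂ) ≅ Z :=
  NatIso.ofComponents app nat

/-- Components of `natIsoOfComponentsComp` (hom, by `rfl`). [cite: GortzWedhorn2020, Prop. 4.16] -/
theorem natIsoOfComponentsComp_hom_app {X₀ : J ⥤ SchemeOver k} (app : ∀ j : J, (X₀ ⋙ bcFunctor k ℂ).obj j ≅ Z.obj j)
    (nat : ∀ {j j' : J} (f : j ⟶ j'), (X₀ ⋙ bcFunctor k ℂ).map f ≫ (app j').hom = (app j).hom ≫ Z.map f) (j : J) :
    (natIsoOfComponentsComp Z app nat).hom.app j = (app j).hom := rfl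

/-- Components of `natIsoOfComponentsComp` (inv, by `rfl`). [cite: GortzWedhorn2020, Prop. 4.16] -/
theorem natIsoOfComponentsComp_inv_app {X₀ : J ⥤ SchemeOver k} (app : ∀ j : J, (X₀ ⋙ bcFunctor k ℂ).obj j ≅ Z.obj j)
    (nat : ∀ {j j' : J} (f : j ⟶ j'), (X₀ ⋙ bcFunctor k ℂ).map f ≫ (app j').hom = (app j).hom ≫ Z.map f) (j : J) :
    (natIsoOfComponentsComp Z app nat).inv.app j = (app j).inv := rfl

/-- **The complex form of the descended diagram** `X₀ := N / Gal(L/k)` (`D.descendedFunctor L`): the natural isomorphism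
`e₀ : X₀ ⊗_k ℂ ≅ Z` with components `formApp`. [cite: Deligne1971TravauxShimura, Prop. 5.10 proof (pp. 157–158)] [cite: GortzWedhorn2020, Prop. 4.16 and Thm. 14.83] -/
def descendedForm : (D.descendedFunctor L ⋙ bcFunctor k ℂ) ≅ Z :=
  natIsoOfComponentsComp Z (formAppComp Z L M e i₀ D) fun f ↦ formAppComp_natural Z L M e i₀ D f

/-- The components of `e₀` are `formApp` (hom). [cite: GortzWedhorn2020, Prop. 4.16] -/
theorem descendedForm_hom_app (j : J) : (descendedForm Z L M e i₀ D).hom.app j = (formApp Z L M e i₀ D j).hom :=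
  (natIsoOfComponentsComp_hom_app Z (formAppComp Z L M e i₀ D) (fun f ↦ formAppComp_natural Z L M e i₀ D f) j).trans
    (formAppComp_hom Z L M e i₀ D j)

/-- The components of `e₀` are `formApp` (inv). [cite: GortzWedhorn2020, Prop. 4.16] -/
theorem descendedForm_inv_app (j : J) : (descendedForm Z L M e i₀ D).inv.app j = (formApp Z L M e i₀ D j).inv :=
  (natIsoOfComponentsComp_inv_app Z (formAppComp Z L M e i₀ D) (fun f ↦ formAppComp_natural Z L M e i₀ D f) j).trans
    (formAppComp_inv Z L M e i₀ D j)

/-- The components of `e₀` are `formApp` (as isomorphisms). [cite: GortzWedhorn2020, Prop. 4.16] -/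
theorem descendedForm_app (j : J) : (descendedForm Z L M e i₀ D).app j = formApp Z L M e i₀ D j :=
  Iso.ext (descendedForm_hom_app Z L M e i₀ D j)

/-- Component formula (hom), scheme level. [cite: GortzWedhorn2020, Prop. 4.16] -/
theorem descendedForm_hom_app_left (j : J) :
    ((descendedForm Z L M e i₀ D).hom.app j).left =
      ((bcFunctorTowerIso k L ℂ).inv.app (D.obj₀ L j)).left ≫ ((bcFunctor L ℂ).map (D.iso L j).inv).left ≫
        (Theta Z L M e i₀ j).hom := by
  rw [descendedForm_hom_app, formApp_hom_left]

/-- Component formula (inv), scheme level. [cite: GortzWedhorn2020, Prop. 4.16] -/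
theorem descendedForm_inv_app_left (j : J) :
    ((descendedForm Z L M e i₀ D).inv.app j).left =
      (Theta Z L M e i₀ j).inv ≫ ((bcFunctor L ℂ).map (D.iso L j).hom).left ≫
        ((bcFunctorTowerIso k L ℂ).hom.app (D.obj₀ L j)).left := by
  rw [descendedForm_inv_app, formApp_inv_left]

/-! ### §2. The Galois twists of the form: `e₀⁻¹ ≫ gal σ̃ ≫ e₀ = Θ⁻¹ ≫ (ρ γ ⊠ σ̃) ≫ Θ` -/

/-- **The `e₀`-conjugate of the Galois automorphism `1 × Spec σ̃⁻¹` of `X₀ j ⊗_k ℂ` is `Θ⁻¹ ≫ (ρ_j γ ⊠ σ̃) ≫ Θ`** for every `σ̃ ∈ Aut(ℂ/k)`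
extending `γ ∈ Gal(L/k)`: by the tower (`gal σ̃` read on `(X₀ j ⊗_k L) ⊗_L ℂ` is `gal γ ⊠ σ̃`, ✔ `twistBC_gal_tower`) and naturality of `⊠`
along the equivariant identification `N j ≅ X₀ j ⊗_k L` (✔ `twistBC_naturality`, ✔ `Datum.aut_hom_iso_hom_left`).
[cite: Deligne1971TravauxShimura, Prop. 5.10 proof and Lemme 5.10.1 (pp. 157–158)] [cite: GortzWedhorn2020, §(14.20), Prop. 4.16] -/
theorem descendedForm_conj_gal_eq_conjTheta_twistBC (j : J) (σt : ℂ ≃ₐ[k] ℂ) (γ : L ≃ₐ[k] L)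
    (hσ : ∀ x : L, (σt : ℂ ≃+* ℂ) (algebraMap L ℂ x) = algebraMap L ℂ (γ x))
    (hρ : ((D.ρ j).aut γ).hom ≫ ((N L M i₀).obj j).hom = ((N L M i₀).obj j).hom ≫ specAut L γ⁻¹) :
    ((descendedForm Z L M e i₀ D).app j).inv.left ≫ gal ℂ ((D.descendedFunctor L).obj j) σt ≫
        ((descendedForm Z L M e i₀ D).app j).hom.left =
      conjTheta Z L M e i₀ j (twistBC ℂ ((N L M i₀).obj j) γ (σt : ℂ ≃+* ℂ) hσ ((D.ρ j).aut γ).hom hρ) := by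
  -- the tower: `(gal γ ⊠ σ̃) ≫ T = T ≫ gal σ̃` on `X₀ j`
  have htower := twistBC_gal_tower ℂ k (D.obj₀ L j) γ γ (fun _ => rfl) σt hσ
  have hTT : ((bcFunctorTowerIso k L ℂ).hom.app (D.obj₀ L j)).left ≫ ((bcFunctorTowerIso k L ℂ).inv.app (D.obj₀ L j)).left = 𝟙 _ :=
    congrArg CommaMorphism.left ((bcFunctorTowerIso k L ℂ).hom_inv_id_app (D.obj₀ L j))
  have h1 : ((bcFunctorTowerIso k L ℂ).hom.app (D.obj₀ L j)).left ≫ gal ℂ (D.obj₀ L j) σt ≫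
      ((bcFunctorTowerIso k L ℂ).inv.app (D.obj₀ L j)).left =
      twistBC ℂ ((bcFunctor k L).obj (D.obj₀ L j)) γ (σt : ℂ ≃+* ℂ) hσ (gal L (D.obj₀ L j) γ)
        (gal_semilinear k (D.obj₀ L j) γ γ fun _ => rfl) := by
    rw [← reassoc_of% htower, hTT]
    exact Category.comp_id _
  -- naturality along the identification `ι_j : N j ≅ X₀ j ⊗_k L`
  have hnat := twistBC_naturality ℂ γ (σt : ℂ ≃+* ℂ) hσ ((D.ρ j).aut γ).hom hρ (gal L (D.obj₀ L j) γ)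
    (gal_semilinear k (D.obj₀ L j) γ γ fun _ => rfl) (D.iso L j).hom (D.aut_hom_iso_hom_left L j γ)
  have hBB : ((bcFunctor L ℂ).map (D.iso L j).hom).left ≫ ((bcFunctor L ℂ).map (D.iso L j).inv).left = 𝟙 _ := by
    rw [← Over.comp_left, ← CategoryTheory.Functor.map_comp, Iso.hom_inv_id, CategoryTheory.Functor.map_id, Over.id_left]
  have h2 : ((bcFunctor L ℂ).map (D.iso L j).hom).left ≫
      twistBC ℂ ((bcFunctor k L).obj (D.obj₀ L j)) γ (σt : ℂ ≃+* ℂ) hσ (gal L (D.obj₀ L j) γ)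
        (gal_semilinear k (D.obj₀ L j) γ γ fun _ => rfl) ≫ ((bcFunctor L ℂ).map (D.iso L j).inv).left =
      twistBC ℂ ((N L M i₀).obj j) γ (σt : ℂ ≃+* ℂ) hσ ((D.ρ j).aut γ).hom hρ := by
    rw [← reassoc_of% hnat, hBB]
    exact Category.comp_id _
  rw [Iso.app_inv, Iso.app_hom, descendedForm_inv_app_left, descendedForm_hom_app_left]
  calc ((Theta Z L M e i₀ j).inv ≫ ((bcFunctor L ℂ).map (D.iso L j).hom).left ≫
          ((bcFunctorTowerIso k L ℂ).hom.app (D.obj₀ L j)).left) ≫ gal ℂ ((D.descendedFunctor L).obj j) σt ≫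
          (((bcFunctorTowerIso k L ℂ).inv.app (D.obj₀ L j)).left ≫ ((bcFunctor L ℂ).map (D.iso L j).inv).left ≫
            (Theta Z L M e i₀ j).hom)
      = (Theta Z L M e i₀ j).inv ≫ ((bcFunctor L ℂ).map (D.iso L j).hom).left ≫
          (((bcFunctorTowerIso k L ℂ).hom.app (D.obj₀ L j)).left ≫ gal ℂ (D.obj₀ L j) σt ≫
            ((bcFunctorTowerIso k L ℂ).inv.app (D.obj₀ L j)).left) ≫
          ((bcFunctor L ℂ).map (D.iso L j).inv).left ≫ (Theta Z L M e i₀ j).hom := by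
        simp only [Category.assoc]; rfl
    _ = (Theta Z L M e i₀ j).inv ≫ (((bcFunctor L ℂ).map (D.iso L j).hom).left ≫
          twistBC ℂ ((bcFunctor k L).obj (D.obj₀ L j)) γ (σt : ℂ ≃+* ℂ) hσ (gal L (D.obj₀ L j) γ)
            (gal_semilinear k (D.obj₀ L j) γ γ fun _ => rfl) ≫ ((bcFunctor L ℂ).map (D.iso L j).inv).left) ≫
          (Theta Z L M e i₀ j).hom := by
        rw [h1]; simp only [Category.assoc]
    _ = (Theta Z L M e i₀ j).inv ≫ twistBC ℂ ((N L M i₀).obj j) γ (σt : ℂ ≃+* ℂ) hσ ((D.ρ j).aut γ).hom hρ ≫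
          (Theta Z L M e i₀ j).hom := by rw [h2]
    _ = conjTheta Z L M e i₀ j (twistBC ℂ ((N L M i₀).obj j) γ (σt : ℂ ≃+* ℂ) hσ ((D.ρ j).aut γ).hom hρ) := rfl

/-- **The descended diagram is a model over `k` with the correct twists**: if the descent datum's action is `Good` at every level and
every `γ ∈ Gal(L/k)`, then for EVERY `σ̃ ∈ Aut(ℂ/k)` the `e₀`-conjugate of the Galois automorphism of `X₀ j ⊗_k ℂ` is a twist for `σ̃`
(restrict `σ̃` to `γ` on `L` — `hres`, e.g. `L / k` normal — and apply `Good` at `σ̃`).  This is the reciprocity over the intersection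
field in [Deligne1971TravauxShimura] Prop. 5.10 («il existe alors un module `M_E(G,h)` sur `E`»), in the abstract setting of D1.
[cite: Deligne1971TravauxShimura, Prop. 5.10 with Lemme 5.10.1 (pp. 157–158)] [cite: Milne2005ShimuraVarieties, Def. 12.8 (62) and Thm. 13.6] -/
theorem tw_gal_descendedForm (hD : ∀ (j : J) (γ : L ≃ₐ[k] L), Good Z Tw L M e i₀ j γ ((D.ρ j).aut γ))
    (hres : ∀ σt : ℂ ≃ₐ[k] ℂ, ∃ γ : L ≃ₐ[k] L, ∀ x : L, (σt : ℂ ≃+* ℂ) (algebraMap L ℂ x) = algebraMap L ℂ (γ x))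
    (j : J) (σt : ℂ ≃ₐ[k] ℂ) :
    Tw j (σt : ℂ ≃+* ℂ)
      (((descendedForm Z L M e i₀ D).app j).inv.left ≫ gal ℂ ((D.descendedFunctor L).obj j) σt ≫
        ((descendedForm Z L M e i₀ D).app j).hom.left) := by
  obtain ⟨γ, hσ⟩ := hres σt
  obtain ⟨hρ, htw⟩ := hD j γ
  rw [descendedForm_conj_gal_eq_conjTheta_twistBC Z L M e i₀ D j σt γ hσ hρ]
  exact htw (σt : ℂ ≃+* ℂ) hσ

/-- The same with the natural-transformation components spelled `e₀.inv.app j` / `e₀.hom.app j`.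
[cite: Deligne1971TravauxShimura, Prop. 5.10 with Lemme 5.10.1 (pp. 157–158)] -/
theorem tw_gal_descendedForm' (hD : ∀ (j : J) (γ : L ≃ₐ[k] L), Good Z Tw L M e i₀ j γ ((D.ρ j).aut γ))
    (hres : ∀ σt : ℂ ≃ₐ[k] ℂ, ∃ γ : L ≃ₐ[k] L, ∀ x : L, (σt : ℂ ≃+* ℂ) (algebraMap L ℂ x) = algebraMap L ℂ (γ x))
    (j : J) (σt : ℂ ≃ₐ[k] ℂ) :
    Tw j (σt : ℂ ≃+* ℂ)
      (((descendedForm Z L M e i₀ D).inv.app j).left ≫ gal ℂ ((D.descendedFunctor L).obj j) σt ≫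
        ((descendedForm Z L M e i₀ D).hom.app j).left) :=
  tw_gal_descendedForm Z Tw L M e i₀ D hD hres j σt

/-- **Packaged**: a diagram `X₀` over `k` with a complex form `e₀ : X₀ ⊗_k ℂ ≅ Z` whose Galois automorphisms, for ALL `σ̃ ∈ Aut(ℂ/k)`, are
twists — from a `Good` descent datum on the model over `L`. [cite: Deligne1971TravauxShimura, Prop. 5.10 (pp. 157–158)] -/
theorem exists_descended_form_tw (hD : ∀ (j : J) (γ : L ≃ₐ[k] L), Good Z Tw L M e i₀ j γ ((D.ρ j).aut γ))
    (hres : ∀ σt : ℂ ≃ₐ[k] ℂ, ∃ γ : L ≃ₐ[k] L, ∀ x : L, (σt : ℂ ≃+* ℂ) (algebraMap L ℂ x) = algebraMap L ℂ (γ x)) :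
    ∃ (X₀ : J ⥤ SchemeOver k) (e₀ : (X₀ ⋙ bcFunctor k ℂ) ≅ Z),
      ∀ (j : J) (σt : ℂ ≃ₐ[k] ℂ),
        Tw j (σt : ℂ ≃+* ℂ) ((e₀.app j).inv.left ≫ gal ℂ (X₀.obj j) σt ≫ (e₀.app j).hom.left) :=
  ⟨D.descendedFunctor L, descendedForm Z L M e i₀ D, fun j σt ↦ tw_gal_descendedForm Z Tw L M e i₀ D hD hres j σt⟩

end Form

end GaloisDescentTwist

end Literature.AlgebraicGeometry.Motives

end
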